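import Mathlib

/-!
# Hasse's theorem via Manin's argument, I: the function field of a Weierstrass curve

This is the first of five files formalising an elementary, characteristic-free proof of
**Hasse's theorem** `|#W(𝔽_q) - q - 1| ≤ 2√q` (Silverman, *AEC* Thm. V.1.1; the named fact
`Literature.NumberTheory.LFunctions.hasse_bound` of `Literature.NumberTheory.LFunctions.RHWave0`) along the lines of Manin's
1956 argument (Manin 1956; Chahal 2021, §10.3, pp. 141–148; Chahal–Soomro–Top 2014, §1).

## The argument (all five files)

Let `W` be an elliptic curve over the finite field `F`, `q = #F`, and let `L = F(W)` be the
function field of `W`, a quadratic extension of `K = F(t)`. Over `L` the curve `W` has the generic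
point `Q = (t, s)` and the Frobenius point `P₀ = (t^q, s^q)`; put `P_n = P₀ + n • Q` (these
correspond to the endomorphisms `φ + n`, cf. Chahal–Soomro–Top 2014, §1). The `x`-coordinate of
`P_n` lies in `K` (it is fixed by the involution `s ↦ -s - a₁t - a₃` of `L/K`, which acts as `-1`
on `Q` and `P₀`); write it as `a/b` in lowest terms and let `d_n = deg a` (`d_n = 0` if `P_n = O`).
Then

1. `d₀ = q`;
2. `d₋₁ = #W(F)` (this file's sequels III–IV: the reduced denominator of `x(P₀ - Q)` has the root
   `α ∈ F` with multiplicity equal to the number of rational points with `x = α`);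
3. the *basic identity* `d_{n-1} + d_{n+1} = 2 d_n + 2` (Chahal 2021, (10.25)), from the `x`-only
   addition/subtraction formulas and Stoll's primitivity certificate for Mathlib's
   `WeierstrassCurve.addSubMap`;

so `d_n = n² + a n + q` with `a = q + 1 - #W(F)` (Chahal 2021, Thm. 10.14), `d_n ≥ 0`, and
`d_n = 0 ⇒ d_{n+1} = 1`, whence `a² ≤ 4q` (Chahal 2021, §10.3, "Proof of the Riemann Hypothesis").

Working over `F(W)` with a general Weierstrass equation (rather than with Manin's quadratic twist
of a short Weierstrass equation) makes the argument uniform in the characteristic, including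
`2` and `3` (compare Chahal–Soomro–Top 2014, who treat characteristic `2` via twists of normal
forms).

## This file

* the tower `F[X] → F[W] → F(W)` (Mathlib's `CoordinateRing`, `FunctionField`) and the generic
  point `genPt W = (gT, gS)`;
* the negation involution `negA`/`negL` (`Y ↦ -Y - a₁X - a₃`) and **its fixed field**:
  `exists_mul_eq_of_negL_eq` — an invariant element of `F(W)` is a quotient of polynomials in `X`
  (uses `Δ ≠ 0` through `2Y + a₁X + a₃ ≠ 0`);
* reduced fractions `IsRep W z a b` (`z = a/b`, `a, b ∈ F[X]` coprime) and their uniqueness up to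
  units;
* for finite `F`: the Frobenius point `frobPt W = (gT^q, gS^q)`, Manin's points
  `maninPt W n = frobPt W + n • genPt W`, and `exists_isRep_xc_maninPt`: their `x`-coordinates lie
  in `F(X)`;
* the remaining *definitions* used by files III–V, with their unfolding lemmas: the slope
  numerators `uPlus = s^q - s`, `uMinus = s^q + s + a₁t + a₃` and `nu u = x(P₀ ± Q) · (t^q - t)²`
  as elements of `F[W]`; the fibre algebras `F[Y]/(W(α, Y))` (`fibPoly`) with the evaluation
  `evA : F[W] → F[Y]/(W(α, Y))` at `X = α`; the trace `tr W = q + 1 - #W(F)`, Manin's degree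
  formula `dg W n = n² + (tr W) n + q` and the induction invariant `St W n` of file V.

## References

* Yu. I. Manin, *On cubic congruences to a prime modulus*, Izv. Akad. Nauk SSSR 20 (1956).
* J. S. Chahal, *Algebraic Number Theory: A Brief Introduction*, CRC Press 2021, §10.3,
  "An Elementary Proof of Hasse's Theorem", pp. 141–148.
* J. S. Chahal, A. Soomro, J. Top, *A supplement to Manin's proof of the Hasse inequality*,
  Rocky Mountain J. Math. 44 (2014), §1.
* J. H. Silverman, *The Arithmetic of Elliptic Curves*, 2nd ed., GTM 106, 2009, Thm. V.1.1.
-/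

noncomputable section

open Polynomial WeierstrassCurve WeierstrassCurve.Affine
open scoped Polynomial.Bivariate

namespace Literature.NumberTheory.EllipticCurves.HasseManin

universe u

variable {F : Type u} [Field F] (W : WeierstrassCurve F)

/-! ### The tower `F[X] → F[W] → F(W)` -/

/-- `F[X] → F[W]` is injective. [folklore] -/
theorem algebraMap_coordinateRing_injective :
    Function.Injective (algebraMap F[X] W.toAffine.CoordinateRing) :=
  AdjoinRoot.of.injective_of_degree_ne_zero (by rw [degree_polynomial]; decide)

/-- `F[X] → F(W)` is injective. [folklore] -/
theorem algebraMap_functionField_injective :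
    Function.Injective (algebraMap F[X] W.toAffine.FunctionField) := by
  rw [IsScalarTower.algebraMap_eq F[X] W.toAffine.CoordinateRing W.toAffine.FunctionField]
  exact (IsFractionRing.injective W.toAffine.CoordinateRing W.toAffine.FunctionField).comp
    (algebraMap_coordinateRing_injective W)

/-- `t`: the image of `X` in the function field `F(W)`. [folklore] -/
def gT : W.toAffine.FunctionField := algebraMap F[X] W.toAffine.FunctionField X

/-- `s`: the image of `Y` in the function field `F(W)`. [folklore] -/
def gS : W.toAffine.FunctionField :=
  algebraMap W.toAffine.CoordinateRing W.toAffine.FunctionField (CoordinateRing.mk W.toAffine Y)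

/-- The structure map `F[X] → F[W]` is the class map on constants (in `Y`). [folklore] -/
theorem algebraMap_coordinateRing_eq_mk (p : F[X]) :
    algebraMap F[X] W.toAffine.CoordinateRing p = CoordinateRing.mk W.toAffine (C p) := by
  rw [AdjoinRoot.algebraMap_eq, CoordinateRing.mk, AdjoinRoot.mk_C]

/-- The class of `Y` in `F[W]` satisfies the Weierstrass equation over `F[X]`. [folklore] -/
theorem mk_Y_sq :
    CoordinateRing.mk W.toAffine Y ^ 2 +
        algebraMap F[X] _ (C W.a₁ * X + C W.a₃) * CoordinateRing.mk W.toAffine Y =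
      algebraMap F[X] W.toAffine.CoordinateRing (X ^ 3 + C W.a₂ * X ^ 2 + C W.a₄ * X + C W.a₆) := by
  have Y_sq : CoordinateRing.mk W.toAffine Y ^ 2 = CoordinateRing.mk W.toAffine
      (C (X ^ 3 + C W.a₂ * X ^ 2 + C W.a₄ * X + C W.a₆) - C (C W.a₁ * X + C W.a₃) * Y) :=
    AdjoinRoot.mk_eq_mk.mpr ⟨1, by rw [WeierstrassCurve.Affine.polynomial]; ring1⟩
  rw [Y_sq, map_sub, map_mul, algebraMap_coordinateRing_eq_mk, algebraMap_coordinateRing_eq_mk]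
  ring

/-- The Weierstrass equation for `(t, s)` in `F(W)`, over `F[X]`. [folklore] -/
theorem gS_sq : gS W ^ 2 + algebraMap F[X] _ (C W.a₁ * X + C W.a₃) * gS W =
    algebraMap F[X] W.toAffine.FunctionField (X ^ 3 + C W.a₂ * X ^ 2 + C W.a₄ * X + C W.a₆) := by
  have h := congrArg (algebraMap W.toAffine.CoordinateRing W.toAffine.FunctionField) (mk_Y_sq W)
  rw [map_add, map_mul, map_pow, ← IsScalarTower.algebraMap_apply,
    ← IsScalarTower.algebraMap_apply] at h
  exact h

/-- Constants of `F[X]` map to constants of `F(W)`. [folklore] -/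
theorem algebraMap_C (a : F) :
    algebraMap F[X] W.toAffine.FunctionField (C a) = algebraMap F W.toAffine.FunctionField a := by
  rw [IsScalarTower.algebraMap_apply F F[X] W.toAffine.FunctionField, Polynomial.algebraMap_eq]

/-- The generic point satisfies the Weierstrass equation. [folklore] -/
theorem equation_gT_gS :
    (W.baseChange W.toAffine.FunctionField).toAffine.Equation (gT W) (gS W) := by
  rw [Affine.equation_iff]
  have h := gS_sq W
  simp only [map_add, map_mul, map_pow, algebraMap_C] at h
  simp only [WeierstrassCurve.baseChange, map_a₁, map_a₂, map_a₃, map_a₄, map_a₆, gT]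
  linear_combination h


/-! ### The curve over its own function field -/

/-- `Δ ≠ 0` survives base change to a field. [folklore] -/
theorem baseChange_Δ_ne_zero [W.IsElliptic] (K : Type*) [Field K] [Algebra F K] :
    (W.baseChange K).Δ ≠ 0 := by
  rw [WeierstrassCurve.baseChange, map_Δ]
  exact (W.isUnit_Δ.map _).ne_zero

/-- Over a field extension of the base, every point on an elliptic curve is nonsingular. [folklore]
-/
theorem nonsingular_iff_equation [W.IsElliptic] (K : Type*) [Field K] [Algebra F K] {x y : K} :
    (W.baseChange K).toAffine.Nonsingular x y ↔ (W.baseChange K).toAffine.Equation x y :=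
  (equation_iff_nonsingular_of_Δ_ne_zero (baseChange_Δ_ne_zero W K)).symm

/-- The negation formula `-(x, y) = (x, -y - a₁x - a₃)` on the base-changed curve. [folklore] -/
theorem baseChange_negY (K : Type*) [Field K] [Algebra F K] (x y : K) :
    (W.baseChange K).toAffine.negY x y = -y - algebraMap F K W.a₁ * x - algebraMap F K W.a₃ := by
  simp [WeierstrassCurve.baseChange, negY]

/-- The image of `a₁X + a₃` in an `F[X]`-algebra. [folklore] -/
theorem algebraMap_linTerm (K : Type*) [Field K] [Algebra F K] [Algebra F[X] K]
    [IsScalarTower F F[X] K] :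
    algebraMap F[X] K (C W.a₁ * X + C W.a₃) =
      algebraMap F K W.a₁ * algebraMap F[X] K X + algebraMap F K W.a₃ := by
  rw [map_add, map_mul, IsScalarTower.algebraMap_apply F F[X] K,
    IsScalarTower.algebraMap_apply F F[X] K, Polynomial.algebraMap_eq]

/-! ### Coefficients of the base-changed curve -/

section coeffs

variable (K : Type*) [Field K] [Algebra F K]

/-- `a₁` of the base-changed curve. [folklore] -/
@[simp] theorem baseChange_a₁' : (W.baseChange K).a₁ = algebraMap F K W.a₁ := rfl

/-- `a₂` of the base-changed curve. [folklore] -/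
@[simp] theorem baseChange_a₂' : (W.baseChange K).a₂ = algebraMap F K W.a₂ := rfl

/-- `a₃` of the base-changed curve. [folklore] -/
@[simp] theorem baseChange_a₃' : (W.baseChange K).a₃ = algebraMap F K W.a₃ := rfl

/-- `a₄` of the base-changed curve. [folklore] -/
@[simp] theorem baseChange_a₄' : (W.baseChange K).a₄ = algebraMap F K W.a₄ := rfl

/-- `a₆` of the base-changed curve. [folklore] -/
@[simp] theorem baseChange_a₆' : (W.baseChange K).a₆ = algebraMap F K W.a₆ := rfl

/-- `b₂` of the base-changed curve. [folklore] -/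
@[simp] theorem baseChange_b₂' : (W.baseChange K).b₂ = algebraMap F K W.b₂ := by
  rw [WeierstrassCurve.baseChange, map_b₂]

/-- `b₄` of the base-changed curve. [folklore] -/
@[simp] theorem baseChange_b₄' : (W.baseChange K).b₄ = algebraMap F K W.b₄ := by
  rw [WeierstrassCurve.baseChange, map_b₄]

/-- `b₆` of the base-changed curve. [folklore] -/
@[simp] theorem baseChange_b₆' : (W.baseChange K).b₆ = algebraMap F K W.b₆ := by
  rw [WeierstrassCurve.baseChange, map_b₆]

/-- `b₈` of the base-changed curve. [folklore] -/
@[simp] theorem baseChange_b₈' : (W.baseChange K).b₈ = algebraMap F K W.b₈ := by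
  rw [WeierstrassCurve.baseChange, map_b₈]

end coeffs

variable [W.IsElliptic]

/-- The generic point `(t, s)` of `W` over its function field.
[cite: ChahalSoomroTop2014, §1 (the point `Q`)] -/
def genPt : (W.baseChange W.toAffine.FunctionField).toAffine.Point :=
  .some (gT W) (gS W) ((nonsingular_iff_equation W _).mpr (equation_gT_gS W))

/-- The generic point is not the point at infinity. [folklore] -/
@[simp] theorem genPt_ne_zero : genPt W ≠ 0 := Point.some_ne_zero _

/-! ### The negation automorphism of `F[W]` and `F(W)` -/

omit [W.IsElliptic] in
/-- Evaluating the Weierstrass polynomial `W(X, Y)` at `Y = x` over a ring map. [folklore] -/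
theorem eval₂_polynomial {T : Type*} [CommRing T] (i : F[X] →+* T) (x : T) :
    eval₂ i x W.toAffine.polynomial =
      x ^ 2 + i (C W.a₁ * X + C W.a₃) * x - i (X ^ 3 + C W.a₂ * X ^ 2 + C W.a₄ * X + C W.a₆) := by
  simp only [WeierstrassCurve.Affine.polynomial, eval₂_sub, eval₂_add, eval₂_mul, eval₂_pow,
    eval₂_X, eval₂_C]

omit [W.IsElliptic] in
/-- The `F[X]`-algebra endomorphism `Y ↦ -Y - a₁ X - a₃` of `F[W]`. [folklore] -/
def negA : W.toAffine.CoordinateRing →ₐ[F[X]] W.toAffine.CoordinateRing :=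
  AdjoinRoot.liftAlgHom W.toAffine.polynomial (Algebra.ofId F[X] _)
    (-CoordinateRing.mk W.toAffine Y - algebraMap F[X] _ (C W.a₁ * X + C W.a₃)) (by
      rw [eval₂_polynomial]
      have h := mk_Y_sq W
      simp only [AlgHom.coe_toRingHom, Algebra.ofId_apply]
      linear_combination h)

omit [W.IsElliptic] in
/-- `negA` sends `Y` to `-Y - a₁X - a₃`. [folklore] -/
theorem negA_mk_Y : negA W (CoordinateRing.mk W.toAffine Y) =
    -CoordinateRing.mk W.toAffine Y - algebraMap F[X] _ (C W.a₁ * X + C W.a₃) :=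
  AdjoinRoot.liftAlgHom_root _ _ _ _

omit [W.IsElliptic] in
/-- `negA` is an involution. [folklore] -/
theorem negA_negA (z : W.toAffine.CoordinateRing) : negA W (negA W z) = z := by
  suffices h : (negA W).comp (negA W) = AlgHom.id F[X] _ from AlgHom.congr_fun h z
  refine AdjoinRoot.algHom_ext ?_
  change negA W (negA W (CoordinateRing.mk W.toAffine Y)) = CoordinateRing.mk W.toAffine Y
  rw [negA_mk_Y, map_sub, map_neg, negA_mk_Y, AlgHom.commutes]
  ring

omit [W.IsElliptic] in
/-- `negA` as an algebra automorphism (it is an involution). [folklore] -/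
def negAEquiv : W.toAffine.CoordinateRing ≃ₐ[F[X]] W.toAffine.CoordinateRing :=
  AlgEquiv.ofAlgHom (negA W) (negA W) (AlgHom.ext (negA_negA W)) (AlgHom.ext (negA_negA W))

omit [W.IsElliptic] in
/-- `negAEquiv` is `negA`. [folklore] -/
@[simp] theorem negAEquiv_apply (z : W.toAffine.CoordinateRing) : negAEquiv W z = negA W z := rfl

omit [W.IsElliptic] in
/-- The involution `s ↦ -s - a₁ t - a₃` of the function field `F(W)` over `F(t)`. [folklore] -/
def negL : W.toAffine.FunctionField ≃ₐ[F[X]] W.toAffine.FunctionField :=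
  IsFractionRing.algEquivOfAlgEquiv (negAEquiv W)

omit [W.IsElliptic] in
/-- `negL` extends `negA`. [folklore] -/
theorem negL_algebraMap (z : W.toAffine.CoordinateRing) :
    negL W (algebraMap _ _ z) = algebraMap _ _ (negA W z) :=
  IsFractionRing.algEquivOfAlgEquiv_algebraMap (negAEquiv W) z

omit [W.IsElliptic] in
/-- `negL` fixes `t`. [folklore] -/
@[simp] theorem negL_gT : negL W (gT W) = gT W := AlgEquiv.commutes _ _

omit [W.IsElliptic] in
/-- `negL` fixes `F[X]`. [folklore] -/
@[simp] theorem negL_algebraMap' (p : F[X]) :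
    negL W (algebraMap F[X] W.toAffine.FunctionField p) = algebraMap F[X] _ p :=
  AlgEquiv.commutes _ _

omit [W.IsElliptic] in
/-- `negL` fixes `F`. [folklore] -/
@[simp] theorem negL_algebraMap_F (a : F) :
    negL W (algebraMap F W.toAffine.FunctionField a) = algebraMap F _ a := by
  rw [IsScalarTower.algebraMap_apply F F[X] W.toAffine.FunctionField, negL_algebraMap']

omit [W.IsElliptic] in
/-- `negL s = -s - a₁t - a₃`. [folklore] -/
theorem negL_gS : negL W (gS W) =
    -gS W - algebraMap F[X] W.toAffine.FunctionField (C W.a₁ * X + C W.a₃) := by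
  rw [gS, negL_algebraMap, negA_mk_Y, map_sub, map_neg, ← IsScalarTower.algebraMap_apply]

omit [W.IsElliptic] in
/-- `negL` is an involution. [folklore] -/
theorem negL_negL (z : W.toAffine.FunctionField) : negL W (negL W z) = z := by
  obtain ⟨a, b, hb, rfl⟩ := IsFractionRing.div_surjective (A := W.toAffine.CoordinateRing) z
  rw [map_div₀, negL_algebraMap, negL_algebraMap, map_div₀, negL_algebraMap, negL_algebraMap,
    negA_negA, negA_negA]


/-! ### The fixed field of the negation involution is `F(X)` -/

omit [W.IsElliptic] in
/-- Every element of `F[W]` is `p + q Y` with `p q ∈ F[X]`. [folklore] -/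
theorem exists_eq_add_mul_Y (z : W.toAffine.CoordinateRing) :
    ∃ p q : F[X],
      z = algebraMap F[X] _ p + algebraMap F[X] _ q * CoordinateRing.mk W.toAffine Y := by
  obtain ⟨p, q, rfl⟩ := CoordinateRing.exists_smul_basis_eq z
  exact ⟨p, q, by simp [Algebra.smul_def]⟩

omit [W.IsElliptic] in
/-- `{1, Y}` is `F[X]`-linearly independent in `F[W]` (Mathlib's `CoordinateRing.basis`). [folklore]
-/
theorem eq_zero_of_add_mul_Y_eq_zero {p q : F[X]}
    (h : algebraMap F[X] _ p + algebraMap F[X] _ q * CoordinateRing.mk W.toAffine Y = 0) :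
    p = 0 ∧ q = 0 :=
  CoordinateRing.smul_basis_eq_zero (by simpa [Algebra.smul_def] using h)

/-- For an elliptic curve, `2 = 0` forces `(a₁, a₃) ≠ (0, 0)` (otherwise `Δ = 0`). [folklore] -/
theorem not_two_eq_zero_and : ¬((2 : F) = 0 ∧ W.a₁ = 0 ∧ W.a₃ = 0) := by
  rintro ⟨h2, h1, h3⟩
  apply W.isUnit_Δ.ne_zero
  simp only [Δ, b₂, b₄, b₆, b₈, h1, h3]
  linear_combination
    (-(8 * W.a₂ ^ 2 * (4 * W.a₂ * W.a₆ - W.a₄ ^ 2)) - 32 * W.a₄ ^ 3 - 216 * W.a₆ ^ 2 +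
      144 * W.a₂ * W.a₄ * W.a₆) * h2

/-- In `F[W]`, `q · (2 Y + a₁ X + a₃) = 0` forces `q = 0`. [folklore] -/
theorem eq_zero_of_mul_two_Y_add (q : F[X])
    (h : algebraMap F[X] W.toAffine.CoordinateRing q *
      (2 * CoordinateRing.mk W.toAffine Y + algebraMap F[X] _ (C W.a₁ * X + C W.a₃)) = 0) :
    q = 0 := by
  have h' : algebraMap F[X] W.toAffine.CoordinateRing (q * (C W.a₁ * X + C W.a₃)) +
      algebraMap F[X] _ (2 * q) * CoordinateRing.mk W.toAffine Y = 0 := by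
    rw [map_mul, map_mul, map_ofNat]
    linear_combination h
  obtain ⟨hc, h2⟩ := eq_zero_of_add_mul_Y_eq_zero W h'
  by_contra hq
  have hc' : C W.a₁ * X + C W.a₃ = 0 := (mul_eq_zero.mp hc).resolve_left hq
  have h2' : (2 : F[X]) = 0 := (mul_eq_zero.mp h2).resolve_right hq
  refine not_two_eq_zero_and W ⟨?_, ?_, ?_⟩
  · have := congrArg (eval 0) h2'
    simpa using this
  · have := congrArg (fun p : F[X] => p.coeff 1) hc'
    simpa using this
  · have := congrArg (eval 0) hc'
    simpa using this

omit [W.IsElliptic] in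
/-- `negA` has trivial kernel. [folklore] -/
theorem negA_ne_zero {z : W.toAffine.CoordinateRing} (hz : z ≠ 0) : negA W z ≠ 0 := fun h =>
  hz (by rw [← negA_negA W z, h, map_zero])

omit [W.IsElliptic] in
/-- The norm `β · negA β` of `β = p + q Y` is the polynomial `p² - (a₁X + a₃) p q - q² f`.
[folklore] -/
theorem mul_negA_eq (p q : F[X]) :
    (algebraMap F[X] _ p + algebraMap F[X] _ q * CoordinateRing.mk W.toAffine Y) *
        negA W (algebraMap F[X] _ p + algebraMap F[X] _ q * CoordinateRing.mk W.toAffine Y) =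
      algebraMap F[X] W.toAffine.CoordinateRing
        (p ^ 2 - (C W.a₁ * X + C W.a₃) * p * q -
          q ^ 2 * (X ^ 3 + C W.a₂ * X ^ 2 + C W.a₄ * X + C W.a₆)) := by
  have h := mk_Y_sq W
  rw [map_add, map_mul, AlgHom.commutes, AlgHom.commutes, negA_mk_Y]
  simp only [map_sub, map_mul, map_pow]
  linear_combination (-(algebraMap F[X] W.toAffine.CoordinateRing q) ^ 2) * h

/-- An element of `F[W]` fixed by the negation involution lies in `F[X]`. [folklore] -/
theorem exists_eq_algebraMap_of_negA_eq {γ : W.toAffine.CoordinateRing} (hγ : negA W γ = γ) :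
    ∃ a : F[X], γ = algebraMap F[X] _ a := by
  obtain ⟨a, b, rfl⟩ := exists_eq_add_mul_Y W γ
  rw [map_add, map_mul, AlgHom.commutes, AlgHom.commutes, negA_mk_Y] at hγ
  have hb : b = 0 := eq_zero_of_mul_two_Y_add W b (by linear_combination -hγ)
  exact ⟨a, by rw [hb, map_zero, zero_mul, add_zero]⟩

/-- **The fixed field of `s ↦ -s - a₁t - a₃` on `F(W)` is `F(t)`**: an invariant element is a
quotient of two polynomials in `t`. [folklore] -/
theorem exists_mul_eq_of_negL_eq {z : W.toAffine.FunctionField} (hz : negL W z = z) :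
    ∃ a N : F[X], N ≠ 0 ∧ z * algebraMap F[X] _ N = algebraMap F[X] _ a := by
  obtain ⟨α, β, hβ, rfl⟩ := IsFractionRing.div_surjective (A := W.toAffine.CoordinateRing) z
  have hβ0 : β ≠ 0 := nonZeroDivisors.ne_zero hβ
  have hβ'0 : negA W β ≠ 0 := negA_ne_zero W hβ0
  have hinj := IsFractionRing.injective W.toAffine.CoordinateRing W.toAffine.FunctionField
  have hβL : algebraMap _ W.toAffine.FunctionField β ≠ 0 := (map_ne_zero_iff _ hinj).mpr hβ0
  have hβ'L : algebraMap _ W.toAffine.FunctionField (negA W β) ≠ 0 :=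
    (map_ne_zero_iff _ hinj).mpr hβ'0
  -- `α' β = α β'`
  have h1 : negA W α * β = α * negA W β := by
    rw [map_div₀, negL_algebraMap, negL_algebraMap, div_eq_div_iff hβ'L hβL, ← map_mul,
      ← map_mul] at hz
    exact hinj hz
  -- hence `γ = α β'` is invariant, so a polynomial in `X`
  obtain ⟨a, ha⟩ := exists_eq_algebraMap_of_negA_eq W (γ := α * negA W β)
    (by rw [map_mul, negA_negA, h1])
  obtain ⟨p, q, hpq⟩ := exists_eq_add_mul_Y W β
  refine ⟨a, p ^ 2 - (C W.a₁ * X + C W.a₃) * p * q -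
    q ^ 2 * (X ^ 3 + C W.a₂ * X ^ 2 + C W.a₄ * X + C W.a₆), ?_, ?_⟩
  · intro hN
    have := mul_negA_eq W p q
    rw [← hpq, hN, map_zero] at this
    exact mul_ne_zero hβ0 hβ'0 this
  · rw [IsScalarTower.algebraMap_apply F[X] W.toAffine.CoordinateRing W.toAffine.FunctionField,
      IsScalarTower.algebraMap_apply F[X] W.toAffine.CoordinateRing W.toAffine.FunctionField,
      ← mul_negA_eq, ← hpq, ← ha, map_mul, map_mul]
    field_simp


/-! ### Reduced fractions -/

omit [W.IsElliptic] in
/-- `IsRep W z a b`: the element `z` of `F(W)` is the quotient `a / b` of the coprime polynomials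
`a, b ∈ F[X]`, `b ≠ 0` (a reduced representation of an element of `F(X) ⊆ F(W)`). [folklore] -/
structure IsRep (z : W.toAffine.FunctionField) (a b : F[X]) : Prop where
  ne_zero : b ≠ 0
  isCoprime : IsCoprime a b
  mul_eq : z * algebraMap F[X] _ b = algebraMap F[X] _ a

namespace IsRep

omit [W.IsElliptic]

variable {W}

/-- A reduced representation `a/b` of `z` gives `z = a/b`. [folklore] -/
theorem eq_div {z : W.toAffine.FunctionField} {a b : F[X]} (h : IsRep W z a b) :
    z = algebraMap F[X] _ a / algebraMap F[X] _ b := by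
  rw [eq_div_iff ((map_ne_zero_iff _ (algebraMap_functionField_injective W)).mpr h.ne_zero),
    h.mul_eq]

/-- Reduced representations exist as soon as some representation exists. [folklore] -/
theorem of_mul_eq {z : W.toAffine.FunctionField} {a b : F[X]} (hb : b ≠ 0)
    (h : z * algebraMap F[X] _ b = algebraMap F[X] _ a) : ∃ a' b', IsRep W z a' b' := by
  classical
  refine ⟨a / GCDMonoid.gcd a b, b / GCDMonoid.gcd a b, right_div_gcd_ne_zero hb,
    isCoprime_div_gcd_div_gcd hb, ?_⟩
  have hg : GCDMonoid.gcd a b ≠ 0 := gcd_ne_zero_of_right hb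
  have hgL : algebraMap F[X] W.toAffine.FunctionField (GCDMonoid.gcd a b) ≠ 0 :=
    (map_ne_zero_iff _ (algebraMap_functionField_injective W)).mpr hg
  apply mul_left_cancel₀ hgL
  rw [mul_left_comm, ← map_mul, ← map_mul,
    EuclideanDomain.mul_div_cancel' hg (gcd_dvd_right a b),
    EuclideanDomain.mul_div_cancel' hg (gcd_dvd_left a b), h]

/-- A polynomial `p` has the reduced representation `p/1`. [folklore] -/
theorem algebraMap (p : F[X]) : IsRep W (algebraMap F[X] _ p) p 1 :=
  ⟨one_ne_zero, isCoprime_one_right, by rw [map_one, mul_one]⟩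

/-- Reduced representations are unique up to units; in particular the degrees are determined.
[folklore] -/
theorem associated {z : W.toAffine.FunctionField} {a b a' b' : F[X]} (h : IsRep W z a b)
    (h' : IsRep W z a' b') : Associated a a' ∧ Associated b b' := by
  have key : a * b' = a' * b := by
    apply algebraMap_functionField_injective W
    rw [map_mul, map_mul, ← h.mul_eq, ← h'.mul_eq]
    ring
  constructor
  · exact associated_of_dvd_dvd
      (h.isCoprime.dvd_of_dvd_mul_right (key ▸ dvd_mul_right a b'))
      (h'.isCoprime.dvd_of_dvd_mul_right (key.symm ▸ dvd_mul_right a' b))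
  · exact associated_of_dvd_dvd
      (h.isCoprime.symm.dvd_of_dvd_mul_left (key.symm ▸ dvd_mul_left b a'))
      (h'.isCoprime.symm.dvd_of_dvd_mul_left (key ▸ dvd_mul_left b' a))

/-- The degrees of numerator and denominator of a reduced representation are well defined.
[folklore] -/
theorem natDegree_eq {z : W.toAffine.FunctionField} {a b a' b' : F[X]} (h : IsRep W z a b)
    (h' : IsRep W z a' b') : a.natDegree = a'.natDegree ∧ b.natDegree = b'.natDegree :=
  ⟨natDegree_eq_of_degree_eq (degree_eq_degree_of_associated (h.associated h').1),
    natDegree_eq_of_degree_eq (degree_eq_degree_of_associated (h.associated h').2)⟩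

end IsRep

/-- An element of `F(W)` fixed by the negation involution has a reduced representation. [folklore]
-/
theorem exists_isRep_of_negL_eq {z : W.toAffine.FunctionField} (hz : negL W z = z) :
    ∃ a b, IsRep W z a b := by
  obtain ⟨a, N, hN, h⟩ := exists_mul_eq_of_negL_eq W hz
  exact IsRep.of_mul_eq hN h

/-! ### Points over the function field -/

section Points

/-- The `x`-coordinate of a point (`0` for the point at infinity). [folklore] -/
def xc {K : Type*} [Field K] [Algebra F K] : (W.baseChange K).toAffine.Point → K
  | 0 => 0
  | .some x _ _ => x

omit [W.IsElliptic] in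
/-- `x(O) = 0` by convention (junk value, never used for `O`). [folklore] -/
@[simp] theorem xc_zero {K : Type*} [Field K] [Algebra F K] :
    xc W (0 : (W.baseChange K).toAffine.Point) = 0 := rfl

omit [W.IsElliptic] in
/-- `x((x, y)) = x`. [folklore] -/
@[simp] theorem xc_some {K : Type*} [Field K] [Algebra F K] {x y : K}
    (h : (W.baseChange K).toAffine.Nonsingular x y) : xc W (.some x y h) = x := rfl

omit [W.IsElliptic] in
/-- `x(-P) = x(P)`. [folklore] -/
@[simp] theorem xc_neg {K : Type*} [Field K] [Algebra F K] (P : (W.baseChange K).toAffine.Point) :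
    xc W (-P) = xc W P := by
  cases P <;> rfl

omit [W.IsElliptic] in
/-- `x` commutes with the action of algebra homomorphisms on points. [folklore] -/
theorem xc_map {K : Type*} [Field K] [DecidableEq K] [Algebra F K] [Algebra F[X] K]
    [IsScalarTower F F[X] K] (f : K →ₐ[F[X]] K) (P : (W.baseChange K).toAffine.Point) :
    xc W (Point.map f P) = f (xc W P) := by
  cases P
  · exact (map_zero f).symm
  · rfl

/-- The negation involution acts as `-1` on the generic point. [folklore] -/
theorem map_negL_genPt : Point.map (negL W : W.toAffine.FunctionField →ₐ[F[X]] _) (genPt W) =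
    -genPt W := by
  rw [genPt, Point.map_some, Point.neg_some]
  congr 1
  · exact negL_gT W
  · change negL W (gS W) = _
    rw [negL_gS, baseChange_negY, algebraMap_linTerm, gT]
    ring

/-- The generic point is nonsingular. [folklore] -/
theorem nonsingular_gT_gS :
    (W.baseChange W.toAffine.FunctionField).toAffine.Nonsingular (gT W) (gS W) :=
  (nonsingular_iff_equation W _).mpr (equation_gT_gS W)

/-- `Q = (t, s)` as an affine point. [folklore] -/
theorem genPt_eq : genPt W = .some (gT W) (gS W) (nonsingular_gT_gS W) := rfl

/-- `x(Q) = t`. [folklore] -/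
theorem xc_genPt : xc W (genPt W) = gT W := rfl

/-- `x(Q) = X / 1` in lowest terms. [folklore] -/
theorem isRep_xc_genPt : IsRep W (xc W (genPt W)) X 1 := IsRep.algebraMap X

variable [Fintype F]

/-- The `q`-power Frobenius of `F(W)`, `q = #F`, as an `F`-algebra endomorphism. [folklore] -/
def frob : W.toAffine.FunctionField →ₐ[F] W.toAffine.FunctionField :=
  FiniteField.frobeniusAlgHom F _

omit [W.IsElliptic] in
/-- `frob z = z^q`. [folklore] -/
theorem frob_apply (z : W.toAffine.FunctionField) : frob W z = z ^ Fintype.card F := rfl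

/-- The Frobenius point `(t^q, s^q)`. [cite: ChahalSoomroTop2014, §1 (the point `P₀`)] -/
def frobPt : (W.baseChange W.toAffine.FunctionField).toAffine.Point :=
  .some (gT W ^ Fintype.card F) (gS W ^ Fintype.card F)
    ((nonsingular_iff_equation W _).mpr (Equation.baseChange (f := frob W) (equation_gT_gS W)))

/-- The Frobenius point is not the point at infinity. [folklore] -/
@[simp] theorem frobPt_ne_zero : frobPt W ≠ 0 := Point.some_ne_zero _

omit [W.IsElliptic] in
/-- `X^q ≠ X` in `F[X]` (`q = #F > 1`). [folklore] -/
theorem X_pow_card_ne_X : (X ^ Fintype.card F : F[X]) ≠ X := by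
  intro h
  have h' := congrArg natDegree h
  rw [natDegree_X_pow, natDegree_X] at h'
  exact Fintype.one_lt_card.ne' h'

omit [W.IsElliptic] in
/-- `t^q ≠ t` in `F(W)`. [folklore] -/
theorem gT_pow_card_ne_gT : gT W ^ Fintype.card F ≠ gT W := by
  rw [gT, ← map_pow]
  exact fun h => X_pow_card_ne_X (algebraMap_functionField_injective W h)

/-- The Frobenius point is nonsingular. [folklore] -/
theorem nonsingular_frob :
    (W.baseChange W.toAffine.FunctionField).toAffine.Nonsingular (gT W ^ Fintype.card F)
      (gS W ^ Fintype.card F) :=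
  (nonsingular_iff_equation W _).mpr (Equation.baseChange (f := frob W) (equation_gT_gS W))

/-- `P₀ = (t^q, s^q)` as an affine point. [folklore] -/
theorem frobPt_eq : frobPt W = .some _ _ (nonsingular_frob W) := rfl

/-- `x(P₀) = t^q`. [folklore] -/
theorem xc_frobPt : xc W (frobPt W) = gT W ^ Fintype.card F := rfl

/-- `x(P₀) = X^q / 1` in lowest terms, so `d₀ = q`. [folklore] -/
theorem isRep_xc_frobPt : IsRep W (xc W (frobPt W)) (X ^ Fintype.card F) 1 := by
  rw [xc_frobPt, gT, ← map_pow]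
  exact IsRep.algebraMap _

omit [W.IsElliptic] in
/-- `negL` commutes with the `q`-power map. [folklore] -/
theorem negL_pow_card (z : W.toAffine.FunctionField) :
    negL W (z ^ Fintype.card F) = frob W (negL W z) := by
  rw [map_pow, frob_apply]

omit [W.IsElliptic] in
/-- `(a₁t + a₃)^q = a₁t^q + a₃`. [folklore] -/
theorem frob_algebraMap_X_mul :
    frob W (algebraMap F[X] W.toAffine.FunctionField (C W.a₁ * X + C W.a₃)) =
      algebraMap F _ W.a₁ * gT W ^ Fintype.card F + algebraMap F _ W.a₃ := by
  rw [algebraMap_linTerm, map_add, map_mul, AlgHom.commutes, AlgHom.commutes, frob_apply, gT]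

/-- The negation involution acts as `-1` on the Frobenius point. [folklore] -/
theorem map_negL_frobPt : Point.map (negL W : W.toAffine.FunctionField →ₐ[F[X]] _) (frobPt W) =
    -frobPt W := by
  rw [frobPt, Point.map_some, Point.neg_some]
  congr 1
  · change negL W _ = _
    rw [map_pow, negL_gT]
  · change negL W _ = _
    rw [negL_pow_card, negL_gS, map_sub, map_neg, frob_algebraMap_X_mul,
      baseChange_negY, frob_apply]
    ring

/-- Manin's points `P_n = (t^q, s^q) + n · (t, s)`.
[cite: Chahal2021, §10.3, "Counting points" (`P_n = P₀ + n(t,1)`); ChahalSoomroTop2014, §1] -/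
def maninPt (n : ℤ) : (W.baseChange W.toAffine.FunctionField).toAffine.Point :=
  frobPt W + n • genPt W

/-- `P₀ + 0 • Q = P₀`. [folklore] -/
theorem maninPt_zero : maninPt W 0 = frobPt W := by
  rw [maninPt, zero_zsmul, add_zero]

/-- `P₁ = P₀ + Q`. [folklore] -/
theorem maninPt_one : maninPt W 1 = frobPt W + genPt W := by
  rw [maninPt, one_zsmul]

/-- `P₋₁ = P₀ - Q`. [folklore] -/
theorem maninPt_neg_one : maninPt W (-1) = frobPt W - genPt W := by
  rw [maninPt, neg_one_zsmul, sub_eq_add_neg]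

/-- `P_{n+1} = P_n + Q`. [folklore] -/
theorem maninPt_add_one (n : ℤ) : maninPt W (n + 1) = maninPt W n + genPt W := by
  rw [maninPt, maninPt, add_zsmul, one_zsmul, add_assoc]

/-- `P_{n-1} = P_n - Q`. [folklore] -/
theorem maninPt_sub_one (n : ℤ) : maninPt W (n - 1) = maninPt W n - genPt W := by
  simp only [maninPt, sub_zsmul, one_zsmul]
  abel

/-- The negation involution acts as `-1` on every `P_n = P₀ + n • Q`. [folklore] -/
theorem map_negL_maninPt (n : ℤ) :
    Point.map (negL W : W.toAffine.FunctionField →ₐ[F[X]] _) (maninPt W n) = -maninPt W n := by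
  rw [maninPt, map_add, map_zsmul, map_negL_frobPt, map_negL_genPt, neg_add, zsmul_neg]

/-- The `x`-coordinates of Manin's points lie in `F(t)`. [folklore] -/
theorem negL_xc_maninPt (n : ℤ) : negL W (xc W (maninPt W n)) = xc W (maninPt W n) := by
  have h := congrArg (xc W) (map_negL_maninPt W n)
  rwa [xc_neg, xc_map] at h

/-- **The `x`-coordinates of Manin's points lie in `F(X)`**: `x(P_n) = a/b` with `a, b ∈ F[X]`
coprime (Chahal–Soomro–Top 2014, §1: `P_n` corresponds to the endomorphism `φ + n`, whose
`x`-coordinate is an even function). [cite: ChahalSoomroTop2014, §1] -/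
theorem exists_isRep_xc_maninPt (n : ℤ) : ∃ a b, IsRep W (xc W (maninPt W n)) a b :=
  exists_isRep_of_negL_eq W (negL_xc_maninPt W n)

end Points

/-! ### The numerators of `x(P₀ ± Q)` in `F[W]` -/

section FrobNumerators

variable [Fintype F]

omit [W.IsElliptic]

/-- `δ = X^q - X` in `F[W]`, `q = #F`. [folklore] -/
def deltaA : W.toAffine.CoordinateRing :=
  algebraMap F[X] W.toAffine.CoordinateRing (X ^ Fintype.card F - X)

/-- The numerator `s^q - s` of the slope of the line through `P₀ = (t^q, s^q)` and `Q = (t, s)`,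
as an element of `F[W]`. [folklore] -/
def uPlus : W.toAffine.CoordinateRing :=
  CoordinateRing.mk W.toAffine Y ^ Fintype.card F - CoordinateRing.mk W.toAffine Y

/-- The numerator `s^q + s + a₁t + a₃` of the slope of the line through `P₀` and `-Q`, as an
element of `F[W]`. [folklore] -/
def uMinus : W.toAffine.CoordinateRing :=
  CoordinateRing.mk W.toAffine Y ^ Fintype.card F + CoordinateRing.mk W.toAffine Y +
    algebraMap F[X] W.toAffine.CoordinateRing (C W.a₁ * X + C W.a₃)

/-- `ν(u) = u² + a₁ u δ - (a₂ + X^q + X) δ² ∈ F[W]`; for `u = u±` this is `x(P₀ ± Q) · δ²` (the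
`x`-only chord formula with slope `u / δ`). [folklore] -/
def nu (v : W.toAffine.CoordinateRing) : W.toAffine.CoordinateRing :=
  v ^ 2 + algebraMap F W.toAffine.CoordinateRing W.a₁ * v * deltaA W -
    (algebraMap F W.toAffine.CoordinateRing W.a₂ +
      algebraMap F[X] W.toAffine.CoordinateRing X ^ Fintype.card F +
      algebraMap F[X] W.toAffine.CoordinateRing X) * deltaA W ^ 2

/-- `δ = t^q - t` in `F(W)`. [folklore] -/
theorem algebraMap_deltaA :
    algebraMap W.toAffine.CoordinateRing W.toAffine.FunctionField (deltaA W) =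
      gT W ^ Fintype.card F - gT W := by
  rw [deltaA, ← IsScalarTower.algebraMap_apply, map_sub, map_pow, gT]

/-- `u₊ = s^q - s` in `F(W)`. [folklore] -/
theorem algebraMap_uPlus :
    algebraMap W.toAffine.CoordinateRing W.toAffine.FunctionField (uPlus W) =
      gS W ^ Fintype.card F - gS W := by
  rw [uPlus, map_sub, map_pow, gS]

/-- `u₋ = s^q - (-s - a₁t - a₃)` in `F(W)`. [folklore] -/
theorem algebraMap_uMinus :
    algebraMap W.toAffine.CoordinateRing W.toAffine.FunctionField (uMinus W) =
      gS W ^ Fintype.card F -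
        (W.baseChange W.toAffine.FunctionField).toAffine.negY (gT W) (gS W) := by
  rw [uMinus, map_add, map_add, map_pow, ← IsScalarTower.algebraMap_apply, algebraMap_linTerm,
    baseChange_negY, ← gS, ← gT]
  ring

/-- The image of `ν(u)` in `F(W)`. [folklore] -/
theorem algebraMap_nu (v : W.toAffine.CoordinateRing) :
    algebraMap W.toAffine.CoordinateRing W.toAffine.FunctionField (nu W v) =
      algebraMap W.toAffine.CoordinateRing W.toAffine.FunctionField v ^ 2 +
          algebraMap F W.toAffine.FunctionField W.a₁ *
            algebraMap W.toAffine.CoordinateRing W.toAffine.FunctionField v *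
            (gT W ^ Fintype.card F - gT W) -
        (algebraMap F W.toAffine.FunctionField W.a₂ + gT W ^ Fintype.card F + gT W) *
          (gT W ^ Fintype.card F - gT W) ^ 2 := by
  simp only [nu, map_sub, map_add, map_mul, map_pow, algebraMap_deltaA,
    ← IsScalarTower.algebraMap_apply, gT]

end FrobNumerators

/-! ### The fibre algebras `F[Y] / (W(α, Y))` -/

section Fibre

variable (α : F)

omit [W.IsElliptic]

/-- `W(α, Y) = Y² + (a₁α + a₃) Y - (α³ + a₂α² + a₄α + a₆) ∈ F[Y]`, the Weierstrass polynomial on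
the fibre `x = α`. [folklore] -/
def fibPoly : F[X] :=
  X ^ 2 + C (W.a₁ * α + W.a₃) * X - C (α ^ 3 + W.a₂ * α ^ 2 + W.a₄ * α + W.a₆)

/-- Evaluating `W(α, Y)` at `Y = y`. [folklore] -/
theorem eval_fibPoly (y : F) : (fibPoly W α).eval y =
    y ^ 2 + (W.a₁ * α + W.a₃) * y - (α ^ 3 + W.a₂ * α ^ 2 + W.a₄ * α + W.a₆) := by
  simp only [fibPoly, eval_sub, eval_add, eval_mul, eval_pow, eval_X, eval_C]

/-- The roots of `W(α, Y)` are the `y` with `(α, y)` on the curve. [folklore] -/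
theorem eval_fibPoly_eq_zero_iff (y : F) :
    (fibPoly W α).eval y = 0 ↔ W.toAffine.Equation α y := by
  rw [eval_fibPoly, WeierstrassCurve.Affine.equation_iff, ← sub_eq_zero]
  constructor <;> intro h <;> linear_combination h

/-- `deg W(α, Y) = 2`. [folklore] -/
theorem natDegree_fibPoly : (fibPoly W α).natDegree = 2 := by
  rw [fibPoly]; compute_degree!

/-- `W(α, Y)` is monic. [folklore] -/
theorem monic_fibPoly : (fibPoly W α).Monic := by
  unfold fibPoly; monicity!

/-- `W(α, Y) ≠ 0`. [folklore] -/
theorem fibPoly_ne_zero : fibPoly W α ≠ 0 := (monic_fibPoly W α).ne_zero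

/-- `deg W(α, Y) = 2` (as a `WithBot ℕ`). [folklore] -/
theorem degree_fibPoly : (fibPoly W α).degree = 2 := by
  rw [degree_eq_natDegree (fibPoly_ne_zero W α), natDegree_fibPoly]; rfl

/-- The fibre algebra `F[Y]/(W(α, Y))` is nontrivial. [folklore] -/
theorem nontrivial_fibAlg : Nontrivial (AdjoinRoot (fibPoly W α)) :=
  AdjoinRoot.nontrivial _ (by rw [degree_fibPoly]; decide)

/-- `F` embeds into the fibre algebra. [folklore] -/
theorem algebraMap_fibAlg_injective :
    Function.Injective (algebraMap F (AdjoinRoot (fibPoly W α))) :=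
  haveI := nontrivial_fibAlg W α
  (algebraMap F _).injective

/-- Evaluating `W(α, Y)` over a ring map. [folklore] -/
theorem eval₂_fibPoly {T : Type*} [CommRing T] (i : F →+* T) (x : T) :
    (fibPoly W α).eval₂ i x =
      x ^ 2 + i (W.a₁ * α + W.a₃) * x - i (α ^ 3 + W.a₂ * α ^ 2 + W.a₄ * α + W.a₆) := by
  simp only [fibPoly, eval₂_sub, eval₂_add, eval₂_mul, eval₂_pow, eval₂_X, eval₂_C]

/-- The relation `Ȳ² = -(a₁α + a₃) Ȳ + (α³ + a₂α² + a₄α + a₆)` in the fibre algebra. [folklore] -/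
theorem root_sq : AdjoinRoot.root (fibPoly W α) ^ 2 =
    -algebraMap F _ (W.a₁ * α + W.a₃) * AdjoinRoot.root (fibPoly W α) +
      algebraMap F _ (α ^ 3 + W.a₂ * α ^ 2 + W.a₄ * α + W.a₆) := by
  have h := AdjoinRoot.eval₂_root (fibPoly W α)
  rw [eval₂_fibPoly, ← AdjoinRoot.algebraMap_eq] at h
  linear_combination h

/-- The evaluation `X ↦ α`, `Y ↦ Ȳ` from `F[W]` to the fibre algebra `F[Y]/(W(α, Y))`.
[folklore] -/
def evA : W.toAffine.CoordinateRing →ₐ[F] AdjoinRoot (fibPoly W α) :=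
  AdjoinRoot.liftAlgHom W.toAffine.polynomial (Polynomial.aeval (algebraMap F _ α))
    (AdjoinRoot.root (fibPoly W α)) (by
      rw [eval₂_polynomial]
      have h := root_sq W α
      simp only [AlgHom.coe_toRingHom, map_add, map_mul, map_pow, aeval_C, aeval_X]
      simp only [map_add, map_mul, map_pow] at h
      linear_combination h)

/-- `ev_α` on `F[X]` is evaluation at `α`. [folklore] -/
@[simp] theorem evA_algebraMap (p : F[X]) :
    evA W α (algebraMap F[X] W.toAffine.CoordinateRing p) = algebraMap F _ (p.eval α) := by
  rw [AdjoinRoot.algebraMap_eq, evA, AdjoinRoot.liftAlgHom_of,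
    aeval_algebraMap_apply_eq_algebraMap_eval]

/-- `ev_α Y = Ȳ`. [folklore] -/
@[simp] theorem evA_mk_Y :
    evA W α (CoordinateRing.mk W.toAffine Y) = AdjoinRoot.root (fibPoly W α) :=
  AdjoinRoot.liftAlgHom_root _ _ _ _

/-- `ev_α` fixes `F`. [folklore] -/
@[simp] theorem evA_algebraMap_F (a : F) :
    evA W α (algebraMap F W.toAffine.CoordinateRing a) = algebraMap F _ a :=
  AlgHom.commutes _ _

variable [Fintype F]

/-- `ev_α δ = α^q - α = 0`. [folklore] -/
@[simp] theorem evA_deltaA : evA W α (deltaA W) = 0 := by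
  rw [deltaA, evA_algebraMap, eval_sub, eval_pow, eval_X, FiniteField.pow_card, sub_self,
    map_zero]

/-- `ev_α ν(u) = (ev_α u)²`. [folklore] -/
theorem evA_nu (v : W.toAffine.CoordinateRing) : evA W α (nu W v) = evA W α v ^ 2 := by
  simp only [nu, map_sub, map_add, map_mul, map_pow, evA_deltaA]
  ring

/-- `ev_α u₊ = Ȳ^q - Ȳ`. [folklore] -/
theorem evA_uPlus : evA W α (uPlus W) =
    AdjoinRoot.root (fibPoly W α) ^ Fintype.card F - AdjoinRoot.root (fibPoly W α) := by
  simp only [uPlus, map_sub, map_pow, evA_mk_Y]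

/-- `ev_α u₋ = Ȳ^q + Ȳ + a₁α + a₃`. [folklore] -/
theorem evA_uMinus : evA W α (uMinus W) =
    AdjoinRoot.root (fibPoly W α) ^ Fintype.card F + AdjoinRoot.root (fibPoly W α) +
      algebraMap F _ (W.a₁ * α + W.a₃) := by
  simp only [uMinus, map_add, map_pow, evA_mk_Y, evA_algebraMap, eval_mul, eval_C, eval_X]

end Fibre

/-! ### Manin's degree function and the induction invariant -/

section Invariant

variable [Fintype F]

omit [W.IsElliptic] in
/-- The trace `a = q + 1 - #W(F)` (`#W(F)` counting the point at infinity).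
[cite: Chahal2021, §10.3 Thm. 10.14 (`a_q`)] -/
def tr : ℤ := (Fintype.card F : ℤ) + 1 - Nat.card W.toAffine.Point

omit [W.IsElliptic] in
/-- `d(n) = n² + a n + q`, Manin's formula for the degree of `x(P₀ + n Q)`.
[cite: Chahal2021, §10.3 Thm. 10.14 (`d_n = n² + a_q n + q`)] -/
def dg (n : ℤ) : ℤ := n ^ 2 + tr W * n + Fintype.card F

omit [W.IsElliptic] in
/-- The second difference of `d` is `2`: `d(n+1) + d(n-1) = 2 d(n) + 2`.
[cite: Chahal2021, §10.3 (10.25) (basic identity)] -/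
theorem dg_rec (n : ℤ) : dg W (n + 1) + dg W (n - 1) = 2 * dg W n + 2 := by
  simp only [dg]; ring

omit [W.IsElliptic] in
/-- `d(0) = q`. [folklore] -/
theorem dg_zero : dg W 0 = Fintype.card F := by simp [dg]

omit [W.IsElliptic] in
/-- `d(-1) = #W(F)`. [folklore] -/
theorem dg_neg_one : dg W (-1) = Nat.card W.toAffine.Point := by simp [dg, tr]; ring

omit [W.IsElliptic] in
/-- `d(1) = 2q + 2 - #W(F)`. [folklore] -/
theorem dg_one : dg W 1 = 2 * Fintype.card F + 2 - Nat.card W.toAffine.Point := by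
  simp [dg, tr]; ring

/-- The induction invariant `St n`: either `P_n = O` and `d(n) = 0`, or `P_n ≠ O` and
`x(P_n) = a/b` in lowest terms with `deg b < deg a = d(n)` (so `d(n)` *is* the degree of the
numerator of `x(P_n)`, with the convention `d = 0` at `O`). [folklore] -/
def St (n : ℤ) : Prop :=
  (maninPt W n = 0 ∧ dg W n = 0) ∨
    (maninPt W n ≠ 0 ∧ ∃ a b : F[X], IsRep W (xc W (maninPt W n)) a b ∧
      b.natDegree < a.natDegree ∧ (a.natDegree : ℤ) = dg W n)

variable {W}

/-- If `St n` holds and `P_n = O` then `d(n) = 0`. [folklore] -/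
theorem St.dg_eq_zero {n : ℤ} (h : St W n) (h0 : maninPt W n = 0) : dg W n = 0 := by
  rcases h with ⟨-, h⟩ | ⟨h, -⟩
  · exact h
  · exact absurd h0 h

/-- If `St n` holds and `P_n ≠ O` then `d(n)` is the degree of the reduced numerator of `x(P_n)`.
[folklore] -/
theorem St.dg_eq_natDegree {n : ℤ} (h : St W n) (h0 : maninPt W n ≠ 0) {a b : F[X]}
    (hrep : IsRep W (xc W (maninPt W n)) a b) : dg W n = a.natDegree := by
  rcases h with ⟨h, -⟩ | ⟨-, a', b', hrep', -, hd⟩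
  · exact absurd h h0
  · rw [← hd, (hrep'.natDegree_eq hrep).1]

/-- If `St n` holds then `d(n) ≥ 0`. [folklore] -/
theorem St.dg_nonneg {n : ℤ} (h : St W n) : 0 ≤ dg W n := by
  rcases h with ⟨-, h⟩ | ⟨-, a, b, -, -, hd⟩
  · rw [h]
  · rw [← hd]; exact Int.natCast_nonneg _

/-- If `St n` holds and `d(n) = 0` then `P_n = O` (a nonzero point has `deg a > deg b ≥ 0`).
[folklore] -/
theorem St.eq_zero_of_dg_eq_zero {n : ℤ} (h : St W n) (h0 : dg W n = 0) : maninPt W n = 0 := by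
  rcases h with ⟨h, -⟩ | ⟨-, a, b, -, hlt, hd⟩
  · exact h
  · rw [h0, Nat.cast_eq_zero] at hd; omega

/-- Constructor for `St n` in the case `P_n ≠ O`. [folklore] -/
theorem st_of_rep {n : ℤ} (h0 : maninPt W n ≠ 0) {a b : F[X]}
    (hrep : IsRep W (xc W (maninPt W n)) a b) (hlt : b.natDegree < a.natDegree)
    (hd : (a.natDegree : ℤ) = dg W n) : St W n :=
  Or.inr ⟨h0, a, b, hrep, hlt, hd⟩

end Invariant

end Literature.NumberTheory.EllipticCurves.HasseManin
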